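import Summits.PneNP.PneNP.Theses.KrwChromaticSteering
import Summits.PneNP.PneNP.Cruxes.StrongComposition.Disproof

/-!
# Sketch — crux idea `easy-outer-door` for stmt-PneNP-18538 (StrongComposition)

Barrier-inversion lens, outer-hardness coordinate.  The crux's recorded kill criterion is Meir 2023
§7 Prop. 9, whose hypothesis class is { m ≥ 2n, L(f) ≥ 2^m / m } (maximally formula-hard OUTER f).
The route's deciding theorem applies weak KRW only along the KRW tower `h_{j+1} = h_j ⋄ g_{j+1}`
(`iterate_levels`: `(m, n) = (k^j, k)`), i.e. at ONE hard-outer level with `m = n` and otherwise at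
outer functions of depth `≤ j·(k + log k + 2) ≤ 2√m·log m` — polynomially EASY relative to their arity,
hence disjoint from Prop. 9's class.  Below: the hard small-outer level is a theorem modulo Meir's γ = 1/25
theorem (`hardSmallOuterFrac_of_meir`, proved), and the door is strong composition (fractional gain)
for easy outer functions only (`EasyOuterFrac`), with the re-glued iteration as first lemma.
-/

namespace Summit.PneNP.PneNP.Cruxes.StrongComposition.EasyOuterDoor

open Literature.Computability.Complexity
/-- The inner-fraction door of card `inner-fraction-door` (verbatim copy of
`InnerFractionDoor.StrongCompositionFrac` in `Cruxes/StrongComposition/InnerFractionDoorSketch.lean`;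
restated so this sketch does not wait for that module to build). -/
def StrongCompositionFrac : Prop :=
  ∃ c k : ℕ, 0 < k ∧ ∀ m n : ℕ, 1 ≤ n → ∀ f : (Fin m → Bool) → Bool, (∃ a b, f a ≠ f b) →
    ∃ g : (Fin n → Bool) → Bool, ∀ P : KWTree (Fin m × Fin n), P.SolvesStrong f g →
      ∃ Q : KWTree (Fin m), Q.Solves f ∧ Q.depth + n / k ≤ P.depth + c * (Nat.log 2 (m * n) + 1)

theorem strongCompositionFrac_of_strongComposition
    (h : Summit.PneNP.PneNP.Theses.KrwChromaticSteering.StrongComposition) :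
    StrongCompositionFrac := by
  obtain ⟨c, hc⟩ := h
  refine ⟨c, 1, Nat.one_pos, fun m n hn f hf => ?_⟩
  obtain ⟨g, hg⟩ := hc m n hn f hf
  refine ⟨g, fun P hP => ?_⟩
  obtain ⟨Q, hQ, hd⟩ := hg P hP
  exact ⟨Q, hQ, by simpa using hd⟩

/-- `f : {0,1}^m → {0,1}` is POLYNOMIALLY EASY: some protocol for `KW_f` has depth `D` with
`D² ≤ 4·m·(⌊log₂ m⌋+1)²`, i.e. `D(f) ≤ 2·√m·(⌊log₂ m⌋+1)`.  Every tower function `h_j`, `j ≥ 2`,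
on `m = k^j` bits is easy (`D(h_j) ≤ j·(k + ⌊log₂ k⌋ + 2)`); no `f` with `L(f) ≥ 2^m/m` (Prop. 9) is,
once `m ≥ 2^10`. -/
def EasyOuter {m : ℕ} (f : (Fin m → Bool) → Bool) : Prop :=
  ∃ Q₀ : KWTree (Fin m), Q₀.Solves f ∧ Q₀.depth * Q₀.depth ≤ 4 * m * (Nat.log 2 m + 1) ^ 2

/-- DOOR (easy-outer fractional strong composition): the crux demanded only for polynomially easy
outer functions. -/
def EasyOuterFrac : Prop :=
  ∃ c k : ℕ, 0 < k ∧ ∀ m n : ℕ, 1 ≤ n → ∀ f : (Fin m → Bool) → Bool, (∃ a b, f a ≠ f b) →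
    EasyOuter f →
    ∃ g : (Fin n → Bool) → Bool, ∀ P : KWTree (Fin m × Fin n), P.SolvesStrong f g →
      ∃ Q : KWTree (Fin m), Q.Solves f ∧ Q.depth + n / k ≤ P.depth + c * (Nat.log 2 (m * n) + 1)

/-- The inner-fraction door (hence the crux, `k = 1`) implies the easy-outer door. -/
theorem easyOuterFrac_of_frac (h : StrongCompositionFrac) : EasyOuterFrac := by
  obtain ⟨c, k, hk, hc⟩ := h
  exact ⟨c, k, hk, fun m n hn f hf _ => hc m n hn f hf⟩

theorem easyOuterFrac_of_strongComposition
    (h : Summit.PneNP.PneNP.Theses.KrwChromaticSteering.StrongComposition) : EasyOuterFrac :=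
  easyOuterFrac_of_frac (strongCompositionFrac_of_strongComposition h)

/-- THE ONE HARD LEVEL (`m ≤ n`, FORMULA-hard outer `f`: every `KW_f` tree has
`log₂ #leaves ≥ m − c_h·(⌊log₂ m⌋+1)`): fractional strong composition with `k = 26`. -/
def HardSmallOuterFrac : Prop :=
  ∀ ch : ℕ, ∃ c : ℕ, ∀ m n : ℕ, 1 ≤ n → m ≤ n → ∀ f : (Fin m → Bool) → Bool, (∃ a b, f a ≠ f b) →
    (∀ Q : KWTree (Fin m), Q.Solves f → m ≤ Nat.log 2 Q.leafCount + ch * (Nat.log 2 m + 1)) →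
    ∃ g : (Fin n → Bool) → Bool, ∀ P : KWTree (Fin m × Fin n), P.SolvesStrong f g →
      ∃ Q : KWTree (Fin m), Q.Solves f ∧ Q.depth + n / 26 ≤ P.depth + c * (Nat.log 2 (m * n) + 1)

/-- PROVED: Meir's theorem (γ = 1/25, named Literature fact) closes the hard small-outer level:
`depth P ≥ (m − c_h·L) + n − 24m/25 − c·L` and `24m/25 + n/26 ≤ 649n/650` for `m ≤ n`, against the
trivial `KW_f` protocol of depth `m + ⌊log₂ m⌋ + 1`. -/
theorem hardSmallOuterFrac_of_meir (hM : MeirStrongComposition) : HardSmallOuterFrac := by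
  intro ch
  obtain ⟨c, hM⟩ := hM
  refine ⟨c + ch + 1, fun m n hn hmn f hf hhard => ?_⟩
  obtain ⟨g, hg⟩ := hM m n hn f hf
  refine ⟨g, fun P hP => ?_⟩
  obtain ⟨Qs, hQs, hQsd⟩ := hg P hP
  have hlq : m ≤ Nat.log 2 Qs.leafCount + ch * (Nat.log 2 m + 1) := hhard Qs hQs
  have hm : 1 ≤ m := Disproof.one_le_of_nonconst hf
  obtain ⟨Q₀, hQ₀, hQ₀d⟩ := Disproof.exists_solves_sendInput hm f
  refine ⟨Q₀, hQ₀, ?_⟩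
  have hlog : Nat.log 2 m ≤ Nat.log 2 (m * n) :=
    Nat.log_mono_right (Nat.le_mul_of_pos_right m hn)
  have hchm : ch * (Nat.log 2 m + 1) ≤ ch * (Nat.log 2 (m * n) + 1) :=
    Nat.mul_le_mul_left _ (by omega)
  have hsplit : (c + ch + 1) * (Nat.log 2 (m * n) + 1)
      = c * (Nat.log 2 (m * n) + 1) + ch * (Nat.log 2 (m * n) + 1) + (Nat.log 2 (m * n) + 1) := by
    ring
  generalize ch * (Nat.log 2 m + 1) = A at *
  generalize ch * (Nat.log 2 (m * n) + 1) = B at *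
  generalize Nat.log 2 (m * n) = L at *
  generalize Nat.log 2 m = lm at *
  generalize Nat.log 2 Qs.leafCount = lq at *
  omega

/-- Support (Riordan–Shannon / Lupanov counting, routine): FORMULA-hard functions exist —
`log₂ L(KW_g) ≥ n − c·(⌊log₂ n⌋+1)` — the base `h_1` of the re-glued tower. -/
def FormulaHardFunctionsExist : Prop :=
  ∃ c : ℕ, ∀ n : ℕ, 1 ≤ n → ∃ g : (Fin n → Bool) → Bool, (∃ a b, g a ≠ g b) ∧
    ∀ Q : KWTree (Fin n), Q.Solves g → n ≤ Nat.log 2 Q.leafCount + c * (Nat.log 2 n + 1)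

/-- FIRST LEMMA of the line (unproved): the KRW tower re-glued — base `h_1` formula-hard on `k` bits,
level 2 by `HardSmallOuterFrac` (`m = n = k`), levels `j ≥ 3` by `EasyOuterFrac` (outer `h_{j-1}` on
`k^{j-1}` bits has depth `≤ (j-1)(k + ⌊log₂ k⌋ + 2) ≤ 2√m·log m`, carried as invariant (ii') via
`depth_compose`), each level converted to standard composition by `StandardFromStrong` (item 18539);
arithmetic as in `exists_hard_function_of_weakKRW` with gain `k/26 ∧ k/k'` per level. -/
def CompositionIterationSplit : Prop :=
  HardSmallOuterFrac → EasyOuterFrac → FormulaHardFunctionsExist →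
    Summit.PneNP.PneNP.Theses.KrwChromaticSteering.StandardFromStrong →
      ∃ L ∈ Classes.P, L ∉ NC1

/-- The re-glued deciding theorem: the crux is replaced by the easy-outer door plus two printed /
routine facts (`MeirStrongComposition`, `FormulaHardFunctionsExist`). -/
theorem closes_easy (hM : MeirStrongComposition) (h1 : EasyOuterFrac)
    (h2 : Summit.PneNP.PneNP.Theses.KrwChromaticSteering.StandardFromStrong)
    (hF : FormulaHardFunctionsExist) (s3 : CompositionIterationSplit)
    (hR : Summit.PneNP.PneNP.Theses.KrwChromaticSteering.FormulaLayerLift) : PneNP := by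
  refine hR fun hsub => ?_
  obtain ⟨L, hLP, hLNC⟩ := s3 (hardSmallOuterFrac_of_meir hM) h1 hF h2
  exact hLNC (hsub hLP)

end Summit.PneNP.PneNP.Cruxes.StrongComposition.EasyOuterDoor
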